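/-
Copyright (c) 2026. Released under Apache 2.0 license.
Literature formalization: Chen–Voutier, §3.1 (the approximating sequences for the simplest quartic
Thue equation), algebraic part.
-/
import Mathlib
import Literature.NumberTheory.DiophantineApproximation.BinomialPadeHomogeneous

/-!
# The hypergeometric approximants for the roots of `X⁴ - tX³ - 6X² + tX + 1` — algebra

[cite: ChenVoutier1997, §3.1 (arXiv:1401.5450), from "Putting `D_r(0) = 8^r/5` …" to
"Therefore, `P_r^{(j)}` and `Q_r^{(j)}` are, in fact, rational integers", and the first display of
the proof of Theorem 5]

J. H. Chen and P. M. Voutier, *Complete solution of the Diophantine equation `X² + 1 = dY⁴` and a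
related family of quartic Thue equations*, J. Number Theory **62** (1997), 71–99.

With `z' = -it + 4`, `u' = -it - 4` (§3.1) and the diagonal Padé polynomials `p_r, q_r` of Lemma 2
for `α = 1/4` (so that `p_r = C(r-1/4,r) X_r = M X_r`, `M = 3·7⋯(4r-1)/(4^r r!)`), the numbers
`P_r := u'^r p_r(z'/u') = M X_r^*(z',u')` and `Q_r := u'^r q_r(z'/u') = M X_r^*(u',z')` are
Gaussian integers (`homogP_quarter_eq_toComplex`: by Siegel's identity and Lemma 4,
`P_r = ∑_s [8^s C(r+1/4,s) C(2r-s,r)] u'^{r-s}` with natural-number coefficients), they are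
complex conjugate up to sign (`homogQ_quarter_eq_conj`, the relation
`X_r^*(u',z') = ± \overline{X_r^*(z',u')}` of §3.1, from `z' = -\overline{u'}`), and their
Casoratian does not vanish (`homogPade_quarter_casoratian_ne_zero`, the first display in the proof
of Theorem 5 with Lemma 7).  Writing `(-i)^r P_r = X_r + i Y_r` with `X_r, Y_r ∈ ℤ`
(`approximantZi`-free: we use the Gaussian integer `(-i)^r ∑_s N_{r,s} u'^{r-s}` directly), we get
`X_r Y_{r+1} - X_{r+1} Y_r ≠ 0` (`re_mul_im_sub_ne_zero`), which is the non-proportionality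
`P_r^{(j)} Q_{r+1}^{(j)} ≠ P_{r+1}^{(j)} Q_r^{(j)}` needed in Lemma 8 for each `j`.
-/

open Finset Complex GaussianInt
open scoped ComplexConjugate

namespace Literature.NumberTheory.DiophantineGeometry.SimplestQuarticThue

open Literature.NumberTheory.DiophantineApproximation

/-! ### The Gaussian integers `z' = 4 - ti`, `u' = -4 - ti` -/

/-- `u' = -it - 4 ≠ 0` [cite: ChenVoutier1997, §3.1]. -/
theorem u'_ne_zero (t : ℤ) : (-4 - (t : ℂ) * I) ≠ 0 := by
  intro h
  have := congrArg Complex.re h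
  simp at this

/-- `z' - u' = 8` [cite: ChenVoutier1997, §3.1, `1 - w = -8/u'`]. -/
theorem z'_sub_u' (t : ℤ) : (4 - (t : ℂ) * I) - (-4 - (t : ℂ) * I) = 8 := by ring

/-- `z' ≠ u'` [cite: ChenVoutier1997, §3.1]. -/
theorem z'_ne_u' (t : ℤ) : (4 - (t : ℂ) * I) ≠ (-4 - (t : ℂ) * I) := by
  intro h
  have h8 := z'_sub_u' t
  rw [h, sub_self] at h8
  norm_num at h8

/-- `w - 1 = 8/u'` for `w = z'/u'` [cite: ChenVoutier1997, §3.1, `1 - w = -8/u'`]. -/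
theorem w_sub_one (t : ℤ) :
    (4 - (t : ℂ) * I) / (-4 - (t : ℂ) * I) - 1 = 8 / (-4 - (t : ℂ) * I) := by
  have hu := u'_ne_zero t
  field_simp
  ring

/-- `\overline{z'} = -u'` [cite: ChenVoutier1997, §3.1, "`z' = -\overline{u'}`"]. -/
theorem conj_z' (t : ℤ) : conj (4 - (t : ℂ) * I) = -(-4 - (t : ℂ) * I) := by
  apply Complex.ext <;> simp

/-- `\overline{u'} = -z'` [cite: ChenVoutier1997, §3.1, "`z' = -\overline{u'}`"]. -/
theorem conj_u' (t : ℤ) : conj (-4 - (t : ℂ) * I) = -(4 - (t : ℂ) * I) := by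
  apply Complex.ext <;> simp

/-- `u'` is the image of the Gaussian integer `⟨-4, -t⟩` [folklore]. -/
theorem toComplex_u' (t : ℤ) : toComplex (⟨-4, -t⟩ : GaussianInt) = -4 - (t : ℂ) * I := by
  rw [toComplex_def']
  push_cast
  ring

/-! ### Integrality: `P_r` and `Q_r` are Gaussian integers (Siegel's identity + Lemma 4) -/

/-- **`P_r = u'^r p_r(z'/u') = ∑_s [8^s C(r+1/4,s) C(2r-s,r)] u'^{r-s}` with natural-number
coefficients** [cite: ChenVoutier1997, §3.1, Siegel's identity for `X_r^*(z',u')` and Lemma 4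
("`M X_r^*(z',u')` … are algebraic integers")]. -/
theorem homogP_quarter_eq_sum_nat (t : ℤ) (R : ℕ) :
    ∑ ν ∈ range (R + 1), ((Ring.choose ((R : ℝ) - 1 / 4) (R - ν) *
        Ring.choose ((R : ℝ) + 1 / 4) ν : ℝ) : ℂ) * (4 - (t : ℂ) * I) ^ ν *
          (-4 - (t : ℂ) * I) ^ (R - ν) =
      ∑ s ∈ range (R + 1), (((2 * R - s).choose R *
        ((2 ^ s * ∏ i ∈ range s, (4 * (R - s + 1 + i) + 1)) / s.factorial) : ℕ) : ℂ) *
          (-4 - (t : ℂ) * I) ^ (R - s) := by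
  have hu := u'_ne_zero t
  rw [homog_eq_pow_mul_sum _ _ _ hu, binomialPadeP_eq_sum_pow_sub_one (1 / 4) R R, mul_sum,
    w_sub_one]
  refine sum_congr rfl fun s hs => ?_
  have hsR : s ≤ R := Nat.lt_succ_iff.mp (mem_range.mp hs)
  rw [ring_choose_two_mul_sub R s hsR, ← Complex.ofReal_natCast,
    ← eight_pow_mul_choose_add_quarter_mul_choose hsR, div_pow,
    ← pow_sub_mul_pow (-4 - (t : ℂ) * I) hsR]
  push_cast
  field_simp

/-- **`Q_r = u'^r q_r(z'/u') = ∑_s [8^s C(r-1/4,s) C(2r-s,r)] u'^{r-s}` with natural-number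
coefficients** [cite: ChenVoutier1997, §3.1, Siegel's identity for `X_r^*(u',z')` and Lemma 4]. -/
theorem homogQ_quarter_eq_sum_nat (t : ℤ) (R : ℕ) :
    ∑ ν ∈ range (R + 1), ((Ring.choose ((R : ℝ) - 1 / 4) ν *
        Ring.choose ((R : ℝ) + 1 / 4) (R - ν) : ℝ) : ℂ) * (4 - (t : ℂ) * I) ^ ν *
          (-4 - (t : ℂ) * I) ^ (R - ν) =
      ∑ s ∈ range (R + 1), (((2 * R - s).choose R *
        ((2 ^ s * ∏ i ∈ range s, (4 * (R - s + i) + 3)) / s.factorial) : ℕ) : ℂ) *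
          (-4 - (t : ℂ) * I) ^ (R - s) := by
  have hu := u'_ne_zero t
  rw [homog_eq_pow_mul_sum _ _ _ hu, binomialPadeQ_eq_sum_pow_sub_one (1 / 4) R R, mul_sum,
    w_sub_one]
  refine sum_congr rfl fun s hs => ?_
  have hsR : s ≤ R := Nat.lt_succ_iff.mp (mem_range.mp hs)
  rw [ring_choose_two_mul_sub R s hsR, ← Complex.ofReal_natCast,
    ← eight_pow_mul_choose_sub_quarter_mul_choose hsR, div_pow,
    ← pow_sub_mul_pow (-4 - (t : ℂ) * I) hsR]
  push_cast
  field_simp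

/-- `P_r` is the Gaussian integer `∑_s N⁺_{r,s} (-4 - ti)^{r-s}`
[cite: ChenVoutier1997, §3.1, "`P_r^{(j)}` and `Q_r^{(j)}` are … rational integers"]. -/
theorem homogP_quarter_eq_toComplex (t : ℤ) (R : ℕ) :
    ∑ ν ∈ range (R + 1), ((Ring.choose ((R : ℝ) - 1 / 4) (R - ν) *
        Ring.choose ((R : ℝ) + 1 / 4) ν : ℝ) : ℂ) * (4 - (t : ℂ) * I) ^ ν *
          (-4 - (t : ℂ) * I) ^ (R - ν) =
      toComplex (∑ s ∈ range (R + 1), (((2 * R - s).choose R *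
        ((2 ^ s * ∏ i ∈ range s, (4 * (R - s + 1 + i) + 1)) / s.factorial) : ℕ) : GaussianInt) *
          (⟨-4, -t⟩ : GaussianInt) ^ (R - s)) := by
  rw [homogP_quarter_eq_sum_nat, map_sum]
  refine sum_congr rfl fun s _ => ?_
  rw [map_mul, map_pow, map_natCast, toComplex_u']

/-- `Q_r` is the Gaussian integer `∑_s N⁻_{r,s} (-4 - ti)^{r-s}`
[cite: ChenVoutier1997, §3.1, "`P_r^{(j)}` and `Q_r^{(j)}` are … rational integers"]. -/
theorem homogQ_quarter_eq_toComplex (t : ℤ) (R : ℕ) :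
    ∑ ν ∈ range (R + 1), ((Ring.choose ((R : ℝ) - 1 / 4) ν *
        Ring.choose ((R : ℝ) + 1 / 4) (R - ν) : ℝ) : ℂ) * (4 - (t : ℂ) * I) ^ ν *
          (-4 - (t : ℂ) * I) ^ (R - ν) =
      toComplex (∑ s ∈ range (R + 1), (((2 * R - s).choose R *
        ((2 ^ s * ∏ i ∈ range s, (4 * (R - s + i) + 3)) / s.factorial) : ℕ) : GaussianInt) *
          (⟨-4, -t⟩ : GaussianInt) ^ (R - s)) := by
  rw [homogQ_quarter_eq_sum_nat, map_sum]
  refine sum_congr rfl fun s _ => ?_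
  rw [map_mul, map_pow, map_natCast, toComplex_u']

/-! ### Conjugation symmetry and the Casoratian -/

/-- **`Q_r = (-1)^r \overline{P_r}`** [cite: ChenVoutier1997, §3.1,
"`X_r^*(u',z') = ± \overline{X_r^*(z',u')}`"] (valid for every real `α`). -/
theorem homogQ_eq_conj (α : ℝ) (t : ℤ) (R : ℕ) :
    ∑ ν ∈ range (R + 1), ((Ring.choose ((R : ℝ) - α) ν *
        Ring.choose ((R : ℝ) + α) (R - ν) : ℝ) : ℂ) * (4 - (t : ℂ) * I) ^ ν *
          (-4 - (t : ℂ) * I) ^ (R - ν) =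
      (-1) ^ R * conj (∑ ν ∈ range (R + 1), ((Ring.choose ((R : ℝ) - α) (R - ν) *
        Ring.choose ((R : ℝ) + α) ν : ℝ) : ℂ) * (4 - (t : ℂ) * I) ^ ν *
          (-4 - (t : ℂ) * I) ^ (R - ν)) := by
  rw [map_sum, mul_sum, ← sum_range_reflect]
  refine sum_congr rfl fun ν hν => ?_
  have hνR : ν ≤ R := Nat.lt_succ_iff.mp (mem_range.mp hν)
  rw [map_mul, map_mul, map_pow, map_pow, Complex.conj_ofReal, conj_z', conj_u',
    show R + 1 - 1 - ν = R - ν by omega, Nat.sub_sub_self hνR, neg_pow (-4 - (t : ℂ) * I),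
    neg_pow (4 - (t : ℂ) * I)]
  have hsign : ((-1 : ℂ)) ^ R * ((-1) ^ (R - ν) * (-1) ^ ν) = 1 := by
    rw [← pow_add, Nat.sub_add_cancel hνR, ← pow_add, ← two_mul, pow_mul]
    norm_num
  linear_combination (-(((Ring.choose ((R : ℝ) - α) (R - ν) * Ring.choose ((R : ℝ) + α) ν :
    ℝ) : ℂ) * (4 - (t : ℂ) * I) ^ (R - ν) * (-4 - (t : ℂ) * I) ^ ν)) * hsign

/-- **The Casoratian `P_{r+1} Q_r - P_r Q_{r+1}` does not vanish** (`α = 1/4`)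
[cite: ChenVoutier1997, proof of Theorem 5, first display, with Lemma 7]. -/
theorem homogPade_quarter_casoratian_ne_zero (t : ℤ) (r : ℕ) :
    (∑ ν ∈ range (r + 1 + 1), ((Ring.choose ((((r + 1 : ℕ)) : ℝ) - 1 / 4) (r + 1 - ν) *
        Ring.choose ((((r + 1 : ℕ)) : ℝ) + 1 / 4) ν : ℝ) : ℂ) * (4 - (t : ℂ) * I) ^ ν *
          (-4 - (t : ℂ) * I) ^ (r + 1 - ν)) *
      (∑ ν ∈ range (r + 1), ((Ring.choose ((r : ℝ) - 1 / 4) ν *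
        Ring.choose ((r : ℝ) + 1 / 4) (r - ν) : ℝ) : ℂ) * (4 - (t : ℂ) * I) ^ ν *
          (-4 - (t : ℂ) * I) ^ (r - ν)) ≠
    (∑ ν ∈ range (r + 1), ((Ring.choose ((r : ℝ) - 1 / 4) (r - ν) *
        Ring.choose ((r : ℝ) + 1 / 4) ν : ℝ) : ℂ) * (4 - (t : ℂ) * I) ^ ν *
          (-4 - (t : ℂ) * I) ^ (r - ν)) *
      (∑ ν ∈ range (r + 1 + 1), ((Ring.choose ((((r + 1 : ℕ)) : ℝ) - 1 / 4) ν *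
        Ring.choose ((((r + 1 : ℕ)) : ℝ) + 1 / 4) (r + 1 - ν) : ℝ) : ℂ) * (4 - (t : ℂ) * I) ^ ν *
          (-4 - (t : ℂ) * I) ^ (r + 1 - ν)) :=
  homogPade_casoratian_ne_zero (1 / 4) (by norm_num) (by rw [abs_of_pos (by norm_num)]; norm_num)
    _ _ (u'_ne_zero t) (z'_ne_u' t) r

/-! ### The integer approximants `X_r + i Y_r = (-i)^r P_r` -/

/-- `toComplex ⟨0, -1⟩ = -i` [folklore]. -/
theorem toComplex_negI : toComplex (⟨0, -1⟩ : GaussianInt) = -I := by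
  rw [toComplex_def']
  push_cast
  ring

/-- The Gaussian integer `(-i)^r ∑_s N⁺_{r,s} (-4-ti)^{r-s}` has complex value `(-i)^r P_r`
[cite: ChenVoutier1997, §3.1, `i^r P_r^{(j)'}`, `i^r Q_r^{(j)'}`]. -/
theorem toComplex_approximantZi (t : ℤ) (R : ℕ) :
    toComplex ((⟨0, -1⟩ : GaussianInt) ^ R * ∑ s ∈ range (R + 1), (((2 * R - s).choose R *
        ((2 ^ s * ∏ i ∈ range s, (4 * (R - s + 1 + i) + 1)) / s.factorial) : ℕ) : GaussianInt) *
          (⟨-4, -t⟩ : GaussianInt) ^ (R - s)) =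
      (-I) ^ R * ∑ ν ∈ range (R + 1), ((Ring.choose ((R : ℝ) - 1 / 4) (R - ν) *
        Ring.choose ((R : ℝ) + 1 / 4) ν : ℝ) : ℂ) * (4 - (t : ℂ) * I) ^ ν *
          (-4 - (t : ℂ) * I) ^ (R - ν) := by
  rw [map_mul, map_pow, toComplex_negI, ← homogP_quarter_eq_toComplex]

/-- The imaginary part of `b \overline{a}` in `ℤ[i]` is `a.re b.im - b.re a.im` [folklore]. -/
theorem im_mul_star (a b : GaussianInt) : (b * star a).im = a.re * b.im - b.re * a.im := by
  simp only [Zsqrtd.im_mul, Zsqrtd.re_star, Zsqrtd.im_star]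
  ring

/-- **Non-proportionality of consecutive approximants** [cite: ChenVoutier1997, proof of
Theorem 5, first display: `P_r^{(j)} Q_{r+1}^{(j)} - P_{r+1}^{(j)} Q_r^{(j)} = (M/2)² D_r D_{r+1}
(A_{r+1}B_r - A_rB_{r+1}) ≠ 0` by Lemma 7]: with `X_r + iY_r := (-i)^r P_r ∈ ℤ[i]`,
`X_r Y_{r+1} - X_{r+1} Y_r ≠ 0`. -/
theorem re_mul_im_sub_ne_zero (t : ℤ) (R : ℕ) :
    ((⟨0, -1⟩ : GaussianInt) ^ R * ∑ s ∈ range (R + 1), (((2 * R - s).choose R *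
        ((2 ^ s * ∏ i ∈ range s, (4 * (R - s + 1 + i) + 1)) / s.factorial) : ℕ) : GaussianInt) *
          (⟨-4, -t⟩ : GaussianInt) ^ (R - s)).re *
      ((⟨0, -1⟩ : GaussianInt) ^ (R + 1) * ∑ s ∈ range (R + 1 + 1), (((2 * (R + 1) - s).choose
        (R + 1) * ((2 ^ s * ∏ i ∈ range s, (4 * (R + 1 - s + 1 + i) + 1)) / s.factorial) : ℕ) :
          GaussianInt) * (⟨-4, -t⟩ : GaussianInt) ^ (R + 1 - s)).im -
    ((⟨0, -1⟩ : GaussianInt) ^ (R + 1) * ∑ s ∈ range (R + 1 + 1), (((2 * (R + 1) - s).choose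
        (R + 1) * ((2 ^ s * ∏ i ∈ range s, (4 * (R + 1 - s + 1 + i) + 1)) / s.factorial) : ℕ) :
          GaussianInt) * (⟨-4, -t⟩ : GaussianInt) ^ (R + 1 - s)).re *
      ((⟨0, -1⟩ : GaussianInt) ^ R * ∑ s ∈ range (R + 1), (((2 * R - s).choose R *
        ((2 ^ s * ∏ i ∈ range s, (4 * (R - s + 1 + i) + 1)) / s.factorial) : ℕ) : GaussianInt) *
          (⟨-4, -t⟩ : GaussianInt) ^ (R - s)).im ≠ 0 := by
  set a := (⟨0, -1⟩ : GaussianInt) ^ R * ∑ s ∈ range (R + 1), (((2 * R - s).choose R *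
    ((2 ^ s * ∏ i ∈ range s, (4 * (R - s + 1 + i) + 1)) / s.factorial) : ℕ) : GaussianInt) *
      (⟨-4, -t⟩ : GaussianInt) ^ (R - s) with ha
  set b := (⟨0, -1⟩ : GaussianInt) ^ (R + 1) * ∑ s ∈ range (R + 1 + 1), (((2 * (R + 1) - s).choose
    (R + 1) * ((2 ^ s * ∏ i ∈ range s, (4 * (R + 1 - s + 1 + i) + 1)) / s.factorial) : ℕ) :
      GaussianInt) * (⟨-4, -t⟩ : GaussianInt) ^ (R + 1 - s) with hb
  rw [← im_mul_star a b]
  intro h0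
  -- the complex values
  set P0 := ∑ ν ∈ range (R + 1), ((Ring.choose ((R : ℝ) - 1 / 4) (R - ν) *
    Ring.choose ((R : ℝ) + 1 / 4) ν : ℝ) : ℂ) * (4 - (t : ℂ) * I) ^ ν *
      (-4 - (t : ℂ) * I) ^ (R - ν) with hP0
  set P1 := ∑ ν ∈ range (R + 1 + 1), ((Ring.choose ((((R + 1 : ℕ)) : ℝ) - 1 / 4) (R + 1 - ν) *
    Ring.choose ((((R + 1 : ℕ)) : ℝ) + 1 / 4) ν : ℝ) : ℂ) * (4 - (t : ℂ) * I) ^ ν *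
      (-4 - (t : ℂ) * I) ^ (R + 1 - ν) with hP1
  set Q0 := ∑ ν ∈ range (R + 1), ((Ring.choose ((R : ℝ) - 1 / 4) ν *
    Ring.choose ((R : ℝ) + 1 / 4) (R - ν) : ℝ) : ℂ) * (4 - (t : ℂ) * I) ^ ν *
      (-4 - (t : ℂ) * I) ^ (R - ν) with hQ0
  set Q1 := ∑ ν ∈ range (R + 1 + 1), ((Ring.choose ((((R + 1 : ℕ)) : ℝ) - 1 / 4) ν *
    Ring.choose ((((R + 1 : ℕ)) : ℝ) + 1 / 4) (R + 1 - ν) : ℝ) : ℂ) * (4 - (t : ℂ) * I) ^ ν *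
      (-4 - (t : ℂ) * I) ^ (R + 1 - ν) with hQ1
  have hA : toComplex a = (-I) ^ R * P0 := toComplex_approximantZi t R
  have hB : toComplex b = (-I) ^ (R + 1) * P1 := toComplex_approximantZi t (R + 1)
  have hQ0c : Q0 = (-1) ^ R * conj P0 := homogQ_eq_conj (1 / 4) t R
  have hQ1c : Q1 = (-1) ^ (R + 1) * conj P1 := homogQ_eq_conj (1 / 4) t (R + 1)
  have hcas : P1 * Q0 ≠ P0 * Q1 := homogPade_quarter_casoratian_ne_zero t R
  -- `toComplex (b ⋆ a)` is real …
  have hreal : toComplex (b * star a) = (((b * star a).re : ℤ) : ℂ) := by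
    rw [toComplex_def, h0]
    simp
  -- … and equals `-i (-1)^R P_1 Q_0`
  have hs : ((-1 : ℂ)) ^ R * (-1) ^ R = 1 := by
    rw [← mul_pow]; norm_num
  have hI : (-I) ^ R * I ^ R = 1 := by
    rw [← mul_pow]; simp
  have hprod : toComplex (b * star a) = -I * (-1) ^ R * (P1 * Q0) := by
    rw [map_mul, toComplex_star, hA, hB, map_mul, map_pow, map_neg, Complex.conj_I, neg_neg,
      hQ0c]
    linear_combination (-I * P1 * conj P0) * hI - (-I * P1 * conj P0) * hs
  -- hence `P_1 Q_0 = i (-1)^R c` with `c` real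
  set c : ℤ := (b * star a).re with hc
  have hII : I * I = -1 := Complex.I_mul_I
  have hV : P1 * Q0 = I * (-1) ^ R * (c : ℂ) := by
    have h := hreal.symm.trans hprod
    linear_combination (-(I * (-1) ^ R)) * h + (P1 * Q0 * (-1) ^ R * (-1) ^ R) * hII -
      (P1 * Q0) * hs
  -- and `P_0 Q_1 = - \overline{P_1 Q_0} = P_1 Q_0`, contradicting the Casoratian
  apply hcas
  have hconjQ0 : conj Q0 = (-1) ^ R * P0 := by
    rw [hQ0c, map_mul, map_pow, map_neg, map_one, Complex.conj_conj]
  have hVc : conj P1 * conj Q0 = -I * (-1) ^ R * (c : ℂ) := by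
    have := congrArg conj hV
    simpa [map_mul, map_pow, Complex.conj_I] using this
  rw [hconjQ0] at hVc
  rw [hQ1c, pow_succ, hV]
  linear_combination hVc

end Literature.NumberTheory.DiophantineGeometry.SimplestQuarticThue
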